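import Summits.HodgeConjecture.HodgeConjecture.Theorems.F0LD2ThetaTensorClasses
import Literature.NumberTheory.Automorphic.Liu2021.Def411WeilCarriersAdmissibleAtLine
import Literature.NumberTheory.Weil1964.AdelicMetaplecticFinRepReindex
import HarnessLib

/-!
# Crux `HLiu418`, line LD1, organ (Gβ) — brick (Gβ1-glue): THE FINITE SLICE OF THE LINE THETA SPAN IS FINITE-DIMENSIONAL
# (for fixed archimedean datum `Φ_∞`, an open compact `K′ ≤ U(diag dV)(𝔸_{L⁺,f})` and ANY character `ξ` of `[U(⟨a⟩)]`, along an ABSTRACT transport `ιA`)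

Cell hodgecm-mathlib (D-0151), FLOOR 0; crux item `HLiu418` = stmt-HodgeConjecture-24832; half-A line LD1 (socket `stub_S1_facts`), organ (Gβ)
`F0LD1ThetaGermDefs.ThetaSlice₂` «a finite-rank equivariant slice of the line theta span», brick **(Gβ1-glue)** of LD1-plan (g2)'s blueprint v1 §3
(vii)–(viii) (DEALS #5 (1); subsumes (Gβ2-v)).  Seat A-p12 (g27).  THEOREMS ONLY (no `def`, no instance, no notation, no named fact, no `sorry`);
`--supports stmt-HodgeConjecture-24832 --as helper`.  Currency = the K1 kit ★ `F0LD1ThetaTransportKit` ∕ ★ `F0LD2ThetaTensorClasses` (abstract adelic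
transport `ιA` with `hιA`), as ruled by LD1-plan (g2) 08:57:54Z ∕ 09:00:11Z.

WHAT.  Fix the CM line frame of ★ `F0LD2ThetaTensorClasses` §2 (`L`, `H`, real diagonal `dV`, an abstract continuous transport `ιA : U(H)(𝔸) →* U(diag dV)(𝔸)`
carrying rational points to rational points, the conjugate-symplectic `μ`, the line `⟨a⟩`, majorants `hρ`, a finite invariant `μW` on `[U(⟨a⟩)]`, a finite
measure `ν` on `[U(H)]`), an archimedean Schwartz datum `φ = Φ_∞`, and a continuous unitary character `ξ` of the compact abelian group `[U(⟨a⟩)]` — ANY `ξ`,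
trivial at `∞` or not.
* §1 `toLp_lineThetaLift_tensor_finPairRep_one_charCM` — `χ_W`-COVARIANCE in the finite factor at a GENERAL `ξ`:
  `[Θ̃_{R_e E(Φ_∞ ⊗ ω_f(1,u)Φ_f)}(ξ) ∘ ιA] = ξ([u]) • [Θ̃_{R_e E(Φ_∞ ⊗ Φ_f)}(ξ) ∘ ιA]` for `u ∈ U(⟨a⟩)(𝔸_{L⁺,f})` (the general-`ξ` twin of ★
  `F0LD2ThetaTensorClasses.toLp_lineThetaLift_tensor_finPairRep_one`, which is the instance `ξ := chiQuot a χ`, `χ ∈ Chi`): the linear map `Φ_f ↦ class`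
  kills the relation module of the `χ′_ξ`-coinvariants of the finite Weil representation, `χ′_ξ(u) := ξ([u])` (through the FINITE PART of `ξ`; no
  triviality at `∞`).
* §2 `finiteDimensional_span_toLp_lineThetaLift_tensor_of_fixed` — for every open compact `K′ ≤ U(diag dV)(𝔸_{L⁺,f})`, the span of the classes
  `[Θ̃_{R_e E(Φ_∞ ⊗ Φ_f)}(ξ) ∘ ιA]` over the `K′ × 1`-FIXED `Φ_f ∈ 𝒮((𝔸_{L⁺,f})^{N×1})` is `FiniteDimensional ℂ` (`n ≥ 2`).  PROOF: the class map descends to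
  the coinvariants `Ω(s_a, χ′_ξ) = Coinv(finPairRepW, χ′_ξ)` (★ `TwistedCoinv.lift`, §1), a `K′`-fixed `Φ_f` has a `K′`-fixed class (★ `WeilCoinv.weilCoinv_mk`),
  and `Ω(s_a, χ′_ξ)` is ADMISSIBLE for EVERY continuous unitary `χ′` (★ `Def411WeilCarriers.isAdmissible_weilCoinv_chiSplittingLine_of_continuous`, rank
  `≥ 2`: Flath ⊗′ + MVW IV.4 + hyperspecial Gelfand pairs, all ★), so its `K′`-fixed vectors are finite-dimensional and so is their image.
* §3 `finiteDimensional_span_toLp_lineThetaLift_tmul_of_fixed` — the same in the junction's `Fin n'` pure-tensor currency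
  `piSchwartzBruhatEquiv L⁺ (Fin n') (φ ⊗ₜ finSBReindex L⁺ e₁ Φ_f)`, `φ : 𝓢((Fin n' → mixedSpace L⁺), ℂ)` (★ `piSBReindex_tmul`,
  ★ `schwartzReindexCLM_schwartzReindexCLM_symm`).
This is [Liu2021, proof of Prop. 4.13 Case 1 (l. 2136–2137)] «`π^∞ ≃ ω(μ, ε_e, χ)`» ∕ [Rallis1984, proof of Thm. 1.2.2] (the finite component of a global
theta lift is a quotient of the coinvariants of `ω_f`) combined with [Liu2021, Def. 4.11] «admissible» — read as a FINITENESS statement on `L²([U(H)])`, with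
no irreducibility and no printed input.

HONEST SCOPE.  Nothing of [Liu2021] is asserted; HC_CM is proved only modulo the 7 printed citations (2 remaining: hLiu418, h413) until rung 0 closes, and
this file discharges none of them (a `--supports` helper of the (Gβ) junction, which supplies the archimedean projector, the `K′`-average and the `μW ∕ hρ`
bookkeeping; the transport of a `K′_H ≤ U(H)(𝔸_f)` to `U(diag dV)(𝔸_f)` is the junction's `hιAf`).

References: [Liu2021] Y. Liu, Camb. J. Math. 9 (2021) = arXiv:2102.11518, Def. 4.11 (l. 2090–2096), proof of Prop. 4.13 Case 1 (l. 2131–2137, p. 48),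
App. D §D.1 Step 3 (l. 5221).  [Rallis1984] S. Rallis, Compositio Math. 51 (1984), proof of Thm. 1.2.2 p. 356.  [BorelJacquet1979] A. Borel, H. Jacquet,
PSPM 33.1 (1979), §4.6.  [BernsteinZelevinsky1976] I. N. Bernstein, A. V. Zelevinsky, Russian Math. Surveys 31 (1976), §2.1.  [GelbartRogawski1991]
S. Gelbart, J. Rogawski, Invent. Math. 105 (1991), §3.2 p. 457.  [MoeglinVignerasWaldspurger1987] LNM 1291, Chap. 2 I.4 Exemple (1) (reindexing).
-/

set_option autoImplicit false
-- the mandated namespace has the single-problem summit's repeated segment (`HodgeConjecture.HodgeConjecture`)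
set_option linter.dupNamespace false

noncomputable section

open NumberField MeasureTheory IsDedekindDomain
open scoped Matrix Kronecker ComplexOrder ENNReal SchwartzMap TensorProduct Classical

namespace Summit.HodgeConjecture.HodgeConjecture.Cruxes.HLiu418.F0LD1ThetaClassFinSliceFinite

open _root_.MeasureTheory
open Literature.NumberTheory.Automorphic Literature.NumberTheory.Automorphic.UnitaryGroup
open Literature.NumberTheory.Automorphic.UnitaryGroup.CotangentForms
open Literature.NumberTheory.Automorphic.IdeleClassGroup
open Literature.NumberTheory.Automorphic.Liu2021
open Literature.NumberTheory.Automorphic.Liu2021.Def411WeilCarriers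
open Literature.NumberTheory.Automorphic.Liu2021.Def411WeilCarriersDoubling
open Literature.NumberTheory.GelbartRogawski1991 Literature.NumberTheory.GelbartRogawski1991.UnitaryDualPair
open Literature.NumberTheory.GelbartRogawski1991.UnitaryDualPair.WeilCoinv
open Literature.NumberTheory.Weil1964
open Literature.RepresentationTheory Literature.RepresentationTheory.Liu2021
open Literature.RepresentationTheory.CompactGroups
open Literature.RepresentationTheory.HeisenbergGroup
open Summit.HodgeConjecture.HodgeConjecture.Cruxes.HLiu418.F0LD1ThetaTransportKit
open Summit.HodgeConjecture.HodgeConjecture.Cruxes.HLiu418.F0LD2ThetaTensorClasses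

section Slice

variable (L : Type) [Field L] [NumberField L] [IsCMField L] (N : ℕ) (H : Matrix (Fin N) (Fin N) L)
  {n' : ℕ} (e₁ : Fin N × Fin 1 ≃ Fin n') (dV : Fin N → L) (hdV : ∀ i, IsCMField.complexConj L (dV i) = dV i)
  (hdV0 : ∀ i, dV i ≠ 0)
  (ιA : (adelicGroupData (↥(maximalRealSubfield L)) L (IsCMField.complexConj L) N H).Adelic →* ↥(UnitaryGroup.adelic (↥(maximalRealSubfield L)) L (IsCMField.complexConj L) N (Matrix.diagonal dV)))
  (hιA : Continuous ιA ∧ ∀ ⦃γ : (adelicGroupData (↥(maximalRealSubfield L)) L (IsCMField.complexConj L) N H).Adelic⦄,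
    γ ∈ (UnitaryGroup.toAdelic (↥(maximalRealSubfield L)) L (IsCMField.complexConj L) N H).range →
      ιA γ ∈ (UnitaryGroup.toAdelic (↥(maximalRealSubfield L)) L (IsCMField.complexConj L) N (Matrix.diagonal dV)).range)
  (μ : Literature.NumberTheory.Automorphic.IdeleClassGroup L →ₜ* Circle) (hμ : IsConjugateSymplectic L μ) (a : (↥(maximalRealSubfield L))ˣ)
  (hρ : HasThetaMajorants fun
      (p : ↥(UnitaryGroup.adelic (↥(maximalRealSubfield L)) L (IsCMField.complexConj L) N (Matrix.diagonal dV)) × ↥(UnitaryGroup.adelic (↥(maximalRealSubfield L)) L (IsCMField.complexConj L) 1 (JW (↥(maximalRealSubfield L)) L a))) (Φ : piSchwartzBruhat (↥(maximalRealSubfield L)) (Fin n')) =>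
        pairRep (↥(maximalRealSubfield L)) L (IsCMField.complexConj L) N 1 e₁ (Matrix.diagonal dV) (JW (↥(maximalRealSubfield L)) L a)
          (chiSplittingLine L e₁ dV hdV hdV0 (toHeckeCharacter L μ) (isUnitary_toHeckeCharacter L μ)
            ((isOscillatorChar_toHeckeCharacter_iff μ).mpr hμ) (TW (↥(maximalRealSubfield L)) a)
            (isUnit_det_TW (↥(maximalRealSubfield L)) a) (JW (↥(maximalRealSubfield L)) L a) (JW_eq (↥(maximalRealSubfield L)) L a))
          p Φ)
  [CompactSpace (↥(UnitaryGroup.adelic (↥(maximalRealSubfield L)) L (IsCMField.complexConj L) N (Matrix.diagonal dV)) ⧸ (UnitaryGroup.toAdelic (↥(maximalRealSubfield L)) L (IsCMField.complexConj L) N (Matrix.diagonal dV)).range)] [MeasurableSpace (↥(UnitaryGroup.adelic (↥(maximalRealSubfield L)) L (IsCMField.complexConj L) 1 (JW (↥(maximalRealSubfield L)) L a)) ⧸ (UnitaryGroup.toAdelic (↥(maximalRealSubfield L)) L (IsCMField.complexConj L) 1 (JW (↥(maximalRealSubfield L)) L a)).range)] (μW : Measure (↥(UnitaryGroup.adelic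 (↥(maximalRealSubfield L)) L (IsCMField.complexConj L) 1 (JW (↥(maximalRealSubfield L)) L a)) ⧸ (UnitaryGroup.toAdelic (↥(maximalRealSubfield L)) L (IsCMField.complexConj L) 1 (JW (↥(maximalRealSubfield L)) L a)).range))
  (φ : 𝓢(((Fin N × Fin 1) → NumberField.mixedEmbedding.mixedSpace ↥(maximalRealSubfield L)), ℂ))
  [CompactSpace (adelicGroupData (↥(maximalRealSubfield L)) L (IsCMField.complexConj L) N H).automorphicQuotient]
  (ν : Measure (adelicGroupData (↥(maximalRealSubfield L)) L (IsCMField.complexConj L) N H).automorphicQuotient) [IsFiniteMeasure ν]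
  [BorelSpace (↥(UnitaryGroup.adelic (↥(maximalRealSubfield L)) L (IsCMField.complexConj L) 1 (JW (↥(maximalRealSubfield L)) L a)) ⧸ (UnitaryGroup.toAdelic (↥(maximalRealSubfield L)) L (IsCMField.complexConj L) 1 (JW (↥(maximalRealSubfield L)) L a)).range)] [IsFiniteMeasure μW]
  [SMulInvariantMeasure ↥(UnitaryGroup.adelic (↥(maximalRealSubfield L)) L (IsCMField.complexConj L) 1 (JW (↥(maximalRealSubfield L)) L a)) (↥(UnitaryGroup.adelic (↥(maximalRealSubfield L)) L (IsCMField.complexConj L) 1 (JW (↥(maximalRealSubfield L)) L a)) ⧸ (UnitaryGroup.toAdelic (↥(maximalRealSubfield L)) L (IsCMField.complexConj L) 1 (JW (↥(maximalRealSubfield L)) L a)).range) μW]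

include hιA

/-! ## §1 `χ_W`-covariance in the finite factor at a GENERAL character `ξ` of `[U(⟨a⟩)]` -/

/-- **`χ_W`-COVARIANCE in the finite factor, general `ξ`**: `[Θ̃_{R_e E(Φ_∞ ⊗ ω_f(1,u)Φ_f)}(ξ) ∘ ιA] = ξ([u]) • [Θ̃_{R_e E(Φ_∞ ⊗ Φ_f)}(ξ) ∘ ιA]`
for `u ∈ U(⟨a⟩)(𝔸_{L⁺,f})` and EVERY continuous unitary character `ξ` of `[U(⟨a⟩)]` (★ `toLp_lineThetaLift_pairRep_one_charCM` at `h = (1, u_𝔸)` + the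
`arch ⊗ fin` factorisation ★ `pairRep_finPairToAdelic_piSBReindex_tmul`; the tree's ★ `toLp_lineThetaLift_tensor_finPairRep_one` is the instance
`ξ := chiQuot a χ`).  I.e. `Φ_f ↦ [Θ̃_{R_e E(Φ_∞ ⊗ Φ_f)}(ξ) ∘ ιA]` kills the relation module of the `χ′_ξ`-coinvariants of ★ `finPairRepW`,
`χ′_ξ(u) = ξ([u])`. [cite: Liu2021, App. D §D.1 Step 3 (l. 5221)] [cite: GelbartRogawski1991, §3.2 p. 457] -/
theorem toLp_lineThetaLift_tensor_finPairRep_one_charCM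
    (ξ : haveI := normal_range_toAdelic_JW L a
      PontryaginDual (↥(UnitaryGroup.adelic (↥(maximalRealSubfield L)) L (IsCMField.complexConj L) 1 (JW (↥(maximalRealSubfield L)) L a)) ⧸ (UnitaryGroup.toAdelic (↥(maximalRealSubfield L)) L (IsCMField.complexConj L) 1 (JW (↥(maximalRealSubfield L)) L a)).range))
    (u : finAdelic (↥(maximalRealSubfield L)) L (IsCMField.complexConj L) 1 (JW (↥(maximalRealSubfield L)) L a))
    (Φf : FinSB (↥(maximalRealSubfield L)) (Fin N × Fin 1)) :
    haveI := normal_range_toAdelic_JW L a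
    MemLp.toLp _ (memLp_toQuotFun_lineThetaLift L N H e₁ dV hdV hdV0 ιA hιA μ hμ a hρ μW
        (piSBReindex (↥(maximalRealSubfield L)) e₁ (piSchwartzBruhatEquiv (↥(maximalRealSubfield L)) (Fin N × Fin 1)
          (φ ⊗ₜ[ℂ] finPairRep (↥(maximalRealSubfield L)) L (IsCMField.complexConj L) N 1 e₁ (Matrix.diagonal dV) (JW (↥(maximalRealSubfield L)) L a)
            (complexConj_imagUnit L) (imagUnit_ne_zero L) (imagUnit_mul_self L) (realDiagonal_isSymm L dV hdV) (isSymm_TW (↥(maximalRealSubfield L)) a)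
            (isUnit_det_realDiagonal L dV hdV hdV0) (isUnit_det_TW (↥(maximalRealSubfield L)) a) (realDiagonal_map L dV hdV).symm
            (JW_eq (↥(maximalRealSubfield L)) L a)
            (isCompatible_chiSplittingLine L e₁ dV hdV hdV0 (toHeckeCharacter L μ) (isUnitary_toHeckeCharacter L μ)
              ((isOscillatorChar_toHeckeCharacter_iff μ).mpr hμ) (TW (↥(maximalRealSubfield L)) a) (isSymm_TW (↥(maximalRealSubfield L)) a)
              (isUnit_det_TW (↥(maximalRealSubfield L)) a) (JW (↥(maximalRealSubfield L)) L a) (JW_eq (↥(maximalRealSubfield L)) L a))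
            (1, u) Φf)))
        (charCM ξ) ν 2) =
      ((ξ (QuotientGroup.mk (finAdelicToAdelic (↥(maximalRealSubfield L)) L (IsCMField.complexConj L) 1 (JW (↥(maximalRealSubfield L)) L a) u)) : Circle) : ℂ) •
        MemLp.toLp _ (memLp_toQuotFun_lineThetaLift L N H e₁ dV hdV hdV0 ιA hιA μ hμ a hρ μW
          (piSBReindex (↥(maximalRealSubfield L)) e₁ (piSchwartzBruhatEquiv (↥(maximalRealSubfield L)) (Fin N × Fin 1) (φ ⊗ₜ[ℂ] Φf)))
          (charCM ξ) ν 2) := by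
  haveI := normal_range_toAdelic_JW L a
  -- `((1,1), (1,u)) = finPairToAdelic (1, u)` in the adelic dual pair
  have hp : ((1, finAdelicToAdelic (↥(maximalRealSubfield L)) L (IsCMField.complexConj L) 1 (JW (↥(maximalRealSubfield L)) L a) u) :
        ↥(UnitaryGroup.adelic (↥(maximalRealSubfield L)) L (IsCMField.complexConj L) N (Matrix.diagonal dV)) ×
          ↥(UnitaryGroup.adelic (↥(maximalRealSubfield L)) L (IsCMField.complexConj L) 1 (JW (↥(maximalRealSubfield L)) L a))) =
      finPairToAdelic (↥(maximalRealSubfield L)) L (IsCMField.complexConj L) N 1 (Matrix.diagonal dV) (JW (↥(maximalRealSubfield L)) L a) (1, u) := by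
    simp only [finPairToAdelic_apply, map_one]
    rfl
  rw [toLp_lineThetaLift_congr L N H e₁ dV hdV hdV0 ιA hιA μ hμ a hρ μW _ ν
    (show piSBReindex (↥(maximalRealSubfield L)) e₁ (piSchwartzBruhatEquiv (↥(maximalRealSubfield L)) (Fin N × Fin 1)
          (φ ⊗ₜ[ℂ] finPairRep (↥(maximalRealSubfield L)) L (IsCMField.complexConj L) N 1 e₁ (Matrix.diagonal dV) (JW (↥(maximalRealSubfield L)) L a)
            (complexConj_imagUnit L) (imagUnit_ne_zero L) (imagUnit_mul_self L) (realDiagonal_isSymm L dV hdV) (isSymm_TW (↥(maximalRealSubfield L)) a)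
            (isUnit_det_realDiagonal L dV hdV hdV0) (isUnit_det_TW (↥(maximalRealSubfield L)) a) (realDiagonal_map L dV hdV).symm
            (JW_eq (↥(maximalRealSubfield L)) L a)
            (isCompatible_chiSplittingLine L e₁ dV hdV hdV0 (toHeckeCharacter L μ) (isUnitary_toHeckeCharacter L μ)
              ((isOscillatorChar_toHeckeCharacter_iff μ).mpr hμ) (TW (↥(maximalRealSubfield L)) a) (isSymm_TW (↥(maximalRealSubfield L)) a)
              (isUnit_det_TW (↥(maximalRealSubfield L)) a) (JW (↥(maximalRealSubfield L)) L a) (JW_eq (↥(maximalRealSubfield L)) L a))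
            (1, u) Φf)) =
        pairRep (↥(maximalRealSubfield L)) L (IsCMField.complexConj L) N 1 e₁ (Matrix.diagonal dV) (JW (↥(maximalRealSubfield L)) L a)
          (chiSplittingLine L e₁ dV hdV hdV0 (toHeckeCharacter L μ) (isUnitary_toHeckeCharacter L μ)
            ((isOscillatorChar_toHeckeCharacter_iff μ).mpr hμ) (TW (↥(maximalRealSubfield L)) a)
            (isUnit_det_TW (↥(maximalRealSubfield L)) a) (JW (↥(maximalRealSubfield L)) L a) (JW_eq (↥(maximalRealSubfield L)) L a))
          ((1, finAdelicToAdelic (↥(maximalRealSubfield L)) L (IsCMField.complexConj L) 1 (JW (↥(maximalRealSubfield L)) L a) u) :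
            ↥(UnitaryGroup.adelic (↥(maximalRealSubfield L)) L (IsCMField.complexConj L) N (Matrix.diagonal dV)) ×
              ↥(UnitaryGroup.adelic (↥(maximalRealSubfield L)) L (IsCMField.complexConj L) 1 (JW (↥(maximalRealSubfield L)) L a)))
          (piSBReindex (↥(maximalRealSubfield L)) e₁ (piSchwartzBruhatEquiv (↥(maximalRealSubfield L)) (Fin N × Fin 1) (φ ⊗ₜ[ℂ] Φf))) by
      rw [hp]
      exact (pairRep_finPairToAdelic_piSBReindex_tmul (↥(maximalRealSubfield L)) L (IsCMField.complexConj L) N 1 e₁ (Matrix.diagonal dV)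
        (JW (↥(maximalRealSubfield L)) L a) (complexConj_imagUnit L) (imagUnit_ne_zero L) (imagUnit_mul_self L) (realDiagonal_isSymm L dV hdV)
        (isSymm_TW (↥(maximalRealSubfield L)) a) (isUnit_det_realDiagonal L dV hdV hdV0) (isUnit_det_TW (↥(maximalRealSubfield L)) a)
        (realDiagonal_map L dV hdV).symm (JW_eq (↥(maximalRealSubfield L)) L a) _ _ φ Φf).symm)]
  exact toLp_lineThetaLift_pairRep_one_charCM L N H e₁ dV hdV hdV0 ιA hιA μ hμ a hρ μW _ ν
    (finAdelicToAdelic (↥(maximalRealSubfield L)) L (IsCMField.complexConj L) 1 (JW (↥(maximalRealSubfield L)) L a) u) ξ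

/-! ## §2 The finite slice of the theta span is finite-dimensional -/

set_option maxHeartbeats 800000 in -- the `weilCoinv`/`finPairRep` telescope at the χ-splitting against the admissibility head (as ★ `omega_center_isAdmissible_of_omegaPi`)
/-- **THE FINITE SLICE OF THE THETA SPAN IS FINITE-DIMENSIONAL.**  For the CM line frame, a fixed archimedean Schwartz datum `Φ_∞ = φ` (e.g. a
Folland–Hermite box vector), an open compact subgroup `K′ ≤ U(diag dV)(𝔸_{L⁺,f})` and ANY continuous unitary character `ξ` of `[U(⟨a⟩)]`, the
ℂ-span in `L²([U(H)], ν)` of the theta classes `[Θ̃_{R_e E(Φ_∞ ⊗ Φ_f)}(ξ) ∘ ιA]` over the `K′ × 1`-FIXED finite Schwartz–Bruhat data `Φ_f` is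
FINITE-DIMENSIONAL (`n ≥ 2`).  PROOF: `Φ_f ↦ class` is linear (★ `toLp_lineThetaLift_tensor_add ∕ _smul`) and `χ′_ξ`-covariant under `U(⟨a⟩)(𝔸_f)`
(§1), hence descends to the coinvariants `Ω(s_a, χ′_ξ)` (★ `TwistedCoinv.lift`); a `K′`-fixed `Φ_f` has a `K′`-fixed class (★ `weilCoinv_mk`);
`Ω(s_a, χ′_ξ)` is admissible for every continuous unitary `χ′` (★ `isAdmissible_weilCoinv_chiSplittingLine_of_continuous` — [Liu2021, Def. 4.11]
«admissible» from Flath ⊗′ + MVW IV.4 + hyperspecial Gelfand pairs, all ★), so `Ω(s_a, χ′_ξ)^{K′}` is finite-dimensional, and the span lies in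
its image.  [Liu2021, proof of Prop. 4.13 Case 1 (l. 2136–2137)] ∕ [Rallis1984, proof of Thm. 1.2.2]: the finite component of a global theta
lift is a quotient of the coinvariants of `ω_f`.
[cite: Liu2021, Def. 4.11 (l. 2092–2096); proof of Prop. 4.13 Case 1 (l. 2136–2137); App. D §D.1 Step 3 (l. 5221)] [cite: Rallis1984, proof of Thm. 1.2.2 p. 356]
[cite: BernsteinZelevinsky1976, §2.1] -/
theorem finiteDimensional_span_toLp_lineThetaLift_tensor_of_fixed (hn' : 2 ≤ n')
    (ξ : haveI := normal_range_toAdelic_JW L a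
      PontryaginDual (↥(UnitaryGroup.adelic (↥(maximalRealSubfield L)) L (IsCMField.complexConj L) 1 (JW (↥(maximalRealSubfield L)) L a)) ⧸ (UnitaryGroup.toAdelic (↥(maximalRealSubfield L)) L (IsCMField.complexConj L) 1 (JW (↥(maximalRealSubfield L)) L a)).range))
    (K' : Subgroup (finAdelic (↥(maximalRealSubfield L)) L (IsCMField.complexConj L) N (Matrix.diagonal dV)))
    (hK'o : IsOpen (K' : Set (finAdelic (↥(maximalRealSubfield L)) L (IsCMField.complexConj L) N (Matrix.diagonal dV))))
    (hK'c : IsCompact (K' : Set (finAdelic (↥(maximalRealSubfield L)) L (IsCMField.complexConj L) N (Matrix.diagonal dV)))) :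
    haveI := normal_range_toAdelic_JW L a
    FiniteDimensional ℂ ↥(Submodule.span ℂ
      {v : ↥(Lp ℂ 2 ν) | ∃ Φf : FinSB (↥(maximalRealSubfield L)) (Fin N × Fin 1),
        (∀ k ∈ K', finPairRep (↥(maximalRealSubfield L)) L (IsCMField.complexConj L) N 1 e₁ (Matrix.diagonal dV) (JW (↥(maximalRealSubfield L)) L a)
            (complexConj_imagUnit L) (imagUnit_ne_zero L) (imagUnit_mul_self L) (realDiagonal_isSymm L dV hdV) (isSymm_TW (↥(maximalRealSubfield L)) a)
            (isUnit_det_realDiagonal L dV hdV hdV0) (isUnit_det_TW (↥(maximalRealSubfield L)) a) (realDiagonal_map L dV hdV).symm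
            (JW_eq (↥(maximalRealSubfield L)) L a)
            (isCompatible_chiSplittingLine L e₁ dV hdV hdV0 (toHeckeCharacter L μ) (isUnitary_toHeckeCharacter L μ)
              ((isOscillatorChar_toHeckeCharacter_iff μ).mpr hμ) (TW (↥(maximalRealSubfield L)) a) (isSymm_TW (↥(maximalRealSubfield L)) a)
              (isUnit_det_TW (↥(maximalRealSubfield L)) a) (JW (↥(maximalRealSubfield L)) L a) (JW_eq (↥(maximalRealSubfield L)) L a))
            (k, 1) Φf = Φf) ∧
        v = MemLp.toLp _ (memLp_toQuotFun_lineThetaLift L N H e₁ dV hdV hdV0 ιA hιA μ hμ a hρ μW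
          (piSBReindex (↥(maximalRealSubfield L)) e₁ (piSchwartzBruhatEquiv (↥(maximalRealSubfield L)) (Fin N × Fin 1) (φ ⊗ₜ[ℂ] Φf)))
          (charCM ξ) ν 2)}) := by
  haveI := normal_range_toAdelic_JW L a
  -- the finite Weil representation at the χ-splitting of the line `⟨a⟩` (abbreviated through its `hs`)
  have hs := isCompatible_chiSplittingLine L e₁ dV hdV hdV0 (toHeckeCharacter L μ) (isUnitary_toHeckeCharacter L μ)
    ((isOscillatorChar_toHeckeCharacter_iff μ).mpr hμ) (TW (↥(maximalRealSubfield L)) a) (isSymm_TW (↥(maximalRealSubfield L)) a)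
    (isUnit_det_TW (↥(maximalRealSubfield L)) a) (JW (↥(maximalRealSubfield L)) L a) (JW_eq (↥(maximalRealSubfield L)) L a)
  -- (1) the character `χ′_ξ(u) = ξ([u])` of `U(⟨a⟩)(𝔸_{L⁺,f})`: unitary and continuous
  set χ' : finAdelic (↥(maximalRealSubfield L)) L (IsCMField.complexConj L) 1 (JW (↥(maximalRealSubfield L)) L a) →* ℂˣ :=
    Circle.toUnits.comp ((ξ : _ →ₜ* Circle).toMonoidHom.comp ((QuotientGroup.mk' _).comp
      (finAdelicToAdelic (↥(maximalRealSubfield L)) L (IsCMField.complexConj L) 1 (JW (↥(maximalRealSubfield L)) L a)))) with hχ'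
  have hχ'v : ∀ u, ((χ' u : ℂˣ) : ℂ) =
      ((ξ (QuotientGroup.mk (finAdelicToAdelic (↥(maximalRealSubfield L)) L (IsCMField.complexConj L) 1 (JW (↥(maximalRealSubfield L)) L a) u)) : Circle) : ℂ) :=
    fun u => rfl
  have hχ'n : ∀ u, ‖((χ' u : ℂˣ) : ℂ)‖ = 1 := fun u => by
    rw [hχ'v]
    exact Circle.norm_coe _
  have hcont : Continuous fun u => ((χ' u : ℂˣ) : ℂ) := by
    simp_rw [hχ'v]
    exact continuous_subtype_val.comp ((ξ : _ →ₜ* Circle).continuous.comp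
      (continuous_quot_mk.comp (continuous_finAdelicToAdelic (↥(maximalRealSubfield L)) L (IsCMField.complexConj L) 1 _)))
  have hχ'c : Continuous χ' := by
    refine Units.continuous_iff.2 ⟨hcont, ?_⟩
    have hinv : (fun u => ((χ' u)⁻¹ : ℂˣ).val) = fun u => ((χ' u⁻¹ : ℂˣ) : ℂ) := by
      funext u; rw [map_inv]
    rw [hinv]
    exact hcont.comp continuous_inv
  -- (2) the class map `Φ_f ↦ [Θ̃_{R_e E(φ ⊗ Φ_f)}(ξ) ∘ ιA]` is linear and `χ′_ξ`-covariant
  let T : FinSB (↥(maximalRealSubfield L)) (Fin N × Fin 1) →ₗ[ℂ] ↥(Lp ℂ 2 ν) :=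
    { toFun := fun Φf => MemLp.toLp _ (memLp_toQuotFun_lineThetaLift L N H e₁ dV hdV hdV0 ιA hιA μ hμ a hρ μW
        (piSBReindex (↥(maximalRealSubfield L)) e₁ (piSchwartzBruhatEquiv (↥(maximalRealSubfield L)) (Fin N × Fin 1) (φ ⊗ₜ[ℂ] Φf))) (charCM ξ) ν 2)
      map_add' := fun Φf Φf' => toLp_lineThetaLift_tensor_add L N H e₁ dV hdV hdV0 ιA hιA μ hμ a hρ μW (charCM ξ) φ ν Φf Φf'
      map_smul' := fun c Φf => toLp_lineThetaLift_tensor_smul L N H e₁ dV hdV hdV0 ιA hιA μ hμ a hρ μW (charCM ξ) φ ν c Φf }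
  have hT : ∀ (u : finAdelic (↥(maximalRealSubfield L)) L (IsCMField.complexConj L) 1 (JW (↥(maximalRealSubfield L)) L a))
      (Φf : FinSB (↥(maximalRealSubfield L)) (Fin N × Fin 1)),
      T (finPairRepW (↥(maximalRealSubfield L)) L (IsCMField.complexConj L) N 1 e₁ (Matrix.diagonal dV) (JW (↥(maximalRealSubfield L)) L a)
        (complexConj_imagUnit L) (imagUnit_ne_zero L) (imagUnit_mul_self L) (realDiagonal_isSymm L dV hdV) (isSymm_TW (↥(maximalRealSubfield L)) a)
        (isUnit_det_realDiagonal L dV hdV hdV0) (isUnit_det_TW (↥(maximalRealSubfield L)) a) (realDiagonal_map L dV hdV).symm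
        (JW_eq (↥(maximalRealSubfield L)) L a) hs u Φf) = ((χ' u : ℂˣ) : ℂ) • T Φf := fun u Φf => by
    rw [hχ'v]
    exact toLp_lineThetaLift_tensor_finPairRep_one_charCM L N H e₁ dV hdV hdV0 ιA hιA μ hμ a hρ μW φ ν ξ u Φf
  -- (3) descend to the coinvariants `Ω(s_a, χ′_ξ)`
  let Tbar := TwistedCoinv.lift (finPairRepW (↥(maximalRealSubfield L)) L (IsCMField.complexConj L) N 1 e₁ (Matrix.diagonal dV)
      (JW (↥(maximalRealSubfield L)) L a) (complexConj_imagUnit L) (imagUnit_ne_zero L) (imagUnit_mul_self L) (realDiagonal_isSymm L dV hdV)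
      (isSymm_TW (↥(maximalRealSubfield L)) a) (isUnit_det_realDiagonal L dV hdV hdV0) (isUnit_det_TW (↥(maximalRealSubfield L)) a)
      (realDiagonal_map L dV hdV).symm (JW_eq (↥(maximalRealSubfield L)) L a) hs) χ' T hT
  -- (4) ADMISSIBILITY: the `K′`-fixed vectors of `Ω(s_a, χ′_ξ)` are finite-dimensional
  have hadm := Def411WeilCarriers.isAdmissible_weilCoinv_chiSplittingLine_of_continuous L e₁ hn' dV hdV hdV0 (toHeckeCharacter L μ)
    (isUnitary_toHeckeCharacter L μ) ((isOscillatorChar_toHeckeCharacter_iff μ).mpr hμ) a χ' hχ'n hχ'c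
  haveI hfin := hadm.finite_fixedPoints ⟨K', hK'o⟩ hK'c
  -- (5) the span lies in the image of the fixed vectors
  refine Submodule.finiteDimensional_of_le (Submodule.span_le.2 ?_ :
    _ ≤ Submodule.map Tbar ((weilCoinv (↥(maximalRealSubfield L)) L (IsCMField.complexConj L) N 1 e₁ (Matrix.diagonal dV)
      (JW (↥(maximalRealSubfield L)) L a) (complexConj_imagUnit L) (imagUnit_ne_zero L) (imagUnit_mul_self L) (realDiagonal_isSymm L dV hdV)
      (isSymm_TW (↥(maximalRealSubfield L)) a) (isUnit_det_realDiagonal L dV hdV hdV0) (isUnit_det_TW (↥(maximalRealSubfield L)) a)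
      (realDiagonal_map L dV hdV).symm (JW_eq (↥(maximalRealSubfield L)) L a) χ' hs).fixedPoints
        ((⟨K', hK'o⟩ : OpenSubgroup (finAdelic (↥(maximalRealSubfield L)) L (IsCMField.complexConj L) N (Matrix.diagonal dV))) :
          Subgroup (finAdelic (↥(maximalRealSubfield L)) L (IsCMField.complexConj L) N (Matrix.diagonal dV)))))
  rintro v ⟨Φf, hfix, rfl⟩
  refine ⟨TwistedCoinv.mk _ χ' Φf, ?_, TwistedCoinv.lift_mk _ χ' T hT Φf⟩
  rw [SetLike.mem_coe, Representation.mem_fixedPoints]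
  intro k hk
  rw [weilCoinv_mk, hfix k hk]


/-! ## §3 The same in the junction's `Fin n'` pure-tensor currency -/

/-- **THE FINITE SLICE IS FINITE-DIMENSIONAL — `Fin n'` currency** (the pure-tensor classes written as in ★ `F0LD2ThetaTorusEigenclass` ∕ ★
`F0LD2ThetaTensorCLM`: `[Θ̃_{E(φ ⊗ R_e^f Φ_f)}(ξ) ∘ ιA]` with `φ : 𝓢((Fin n' → 𝔸_{L⁺,∞}), ℂ)` and the finite datum reindexed to `Fin n'` by ★ `finSBReindex`):
for every open compact `K′ ≤ U(diag dV)(𝔸_{L⁺,f})` the span over the `K′ × 1`-fixed `Φ_f ∈ 𝒮((𝔸_{L⁺,f})^{N×1})` is finite-dimensional (§2 at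
`R_{e⁻¹}^∞ φ` + ★ `piSBReindex_tmul` + ★ `schwartzReindexCLM_schwartzReindexCLM_symm`).
[cite: Liu2021, Def. 4.11 (l. 2092–2096); proof of Prop. 4.13 Case 1 (l. 2136–2137)] [cite: Rallis1984, proof of Thm. 1.2.2 p. 356]
[cite: MoeglinVignerasWaldspurger1987, Chap. 2 I.4 Exemple (1)] -/
theorem finiteDimensional_span_toLp_lineThetaLift_tmul_of_fixed (hn' : 2 ≤ n')
    (ξ : haveI := normal_range_toAdelic_JW L a
      PontryaginDual (↥(UnitaryGroup.adelic (↥(maximalRealSubfield L)) L (IsCMField.complexConj L) 1 (JW (↥(maximalRealSubfield L)) L a)) ⧸ (UnitaryGroup.toAdelic (↥(maximalRealSubfield L)) L (IsCMField.complexConj L) 1 (JW (↥(maximalRealSubfield L)) L a)).range))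
    (K' : Subgroup (finAdelic (↥(maximalRealSubfield L)) L (IsCMField.complexConj L) N (Matrix.diagonal dV)))
    (hK'o : IsOpen (K' : Set (finAdelic (↥(maximalRealSubfield L)) L (IsCMField.complexConj L) N (Matrix.diagonal dV))))
    (hK'c : IsCompact (K' : Set (finAdelic (↥(maximalRealSubfield L)) L (IsCMField.complexConj L) N (Matrix.diagonal dV))))
    (φ₁ : 𝓢((Fin n' → NumberField.mixedEmbedding.mixedSpace ↥(maximalRealSubfield L)), ℂ)) :
    haveI := normal_range_toAdelic_JW L a
    FiniteDimensional ℂ ↥(Submodule.span ℂ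
      {v : ↥(Lp ℂ 2 ν) | ∃ Φf : FinSB (↥(maximalRealSubfield L)) (Fin N × Fin 1),
        (∀ k ∈ K', finPairRep (↥(maximalRealSubfield L)) L (IsCMField.complexConj L) N 1 e₁ (Matrix.diagonal dV) (JW (↥(maximalRealSubfield L)) L a)
            (complexConj_imagUnit L) (imagUnit_ne_zero L) (imagUnit_mul_self L) (realDiagonal_isSymm L dV hdV) (isSymm_TW (↥(maximalRealSubfield L)) a)
            (isUnit_det_realDiagonal L dV hdV hdV0) (isUnit_det_TW (↥(maximalRealSubfield L)) a) (realDiagonal_map L dV hdV).symm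
            (JW_eq (↥(maximalRealSubfield L)) L a)
            (isCompatible_chiSplittingLine L e₁ dV hdV hdV0 (toHeckeCharacter L μ) (isUnitary_toHeckeCharacter L μ)
              ((isOscillatorChar_toHeckeCharacter_iff μ).mpr hμ) (TW (↥(maximalRealSubfield L)) a) (isSymm_TW (↥(maximalRealSubfield L)) a)
              (isUnit_det_TW (↥(maximalRealSubfield L)) a) (JW (↥(maximalRealSubfield L)) L a) (JW_eq (↥(maximalRealSubfield L)) L a))
            (k, 1) Φf = Φf) ∧
        v = MemLp.toLp _ (memLp_toQuotFun_lineThetaLift L N H e₁ dV hdV hdV0 ιA hιA μ hμ a hρ μW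
          (piSchwartzBruhatEquiv (↥(maximalRealSubfield L)) (Fin n') (φ₁ ⊗ₜ[ℂ] finSBReindex (↥(maximalRealSubfield L)) e₁ Φf))
          (charCM ξ) ν 2)}) := by
  haveI := normal_range_toAdelic_JW L a
  -- `E(φ₁ ⊗ R_e^f Φ_f) = R_e E(R_{e⁻¹}^∞ φ₁ ⊗ Φ_f)`
  have hre : ∀ Φf : FinSB (↥(maximalRealSubfield L)) (Fin N × Fin 1),
      piSchwartzBruhatEquiv (↥(maximalRealSubfield L)) (Fin n') (φ₁ ⊗ₜ[ℂ] finSBReindex (↥(maximalRealSubfield L)) e₁ Φf) =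
        piSBReindex (↥(maximalRealSubfield L)) e₁ (piSchwartzBruhatEquiv (↥(maximalRealSubfield L)) (Fin N × Fin 1)
          (schwartzReindexCLM (↥(maximalRealSubfield L)) e₁.symm φ₁ ⊗ₜ[ℂ] Φf)) := fun Φf => by
    rw [piSBReindex_tmul, schwartzReindexCLM_schwartzReindexCLM_symm]
  have hset :
      {v : ↥(Lp ℂ 2 ν) | ∃ Φf : FinSB (↥(maximalRealSubfield L)) (Fin N × Fin 1),
        (∀ k ∈ K', finPairRep (↥(maximalRealSubfield L)) L (IsCMField.complexConj L) N 1 e₁ (Matrix.diagonal dV) (JW (↥(maximalRealSubfield L)) L a)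
            (complexConj_imagUnit L) (imagUnit_ne_zero L) (imagUnit_mul_self L) (realDiagonal_isSymm L dV hdV) (isSymm_TW (↥(maximalRealSubfield L)) a)
            (isUnit_det_realDiagonal L dV hdV hdV0) (isUnit_det_TW (↥(maximalRealSubfield L)) a) (realDiagonal_map L dV hdV).symm
            (JW_eq (↥(maximalRealSubfield L)) L a)
            (isCompatible_chiSplittingLine L e₁ dV hdV hdV0 (toHeckeCharacter L μ) (isUnitary_toHeckeCharacter L μ)
              ((isOscillatorChar_toHeckeCharacter_iff μ).mpr hμ) (TW (↥(maximalRealSubfield L)) a) (isSymm_TW (↥(maximalRealSubfield L)) a)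
              (isUnit_det_TW (↥(maximalRealSubfield L)) a) (JW (↥(maximalRealSubfield L)) L a) (JW_eq (↥(maximalRealSubfield L)) L a))
            (k, 1) Φf = Φf) ∧
        v = MemLp.toLp _ (memLp_toQuotFun_lineThetaLift L N H e₁ dV hdV hdV0 ιA hιA μ hμ a hρ μW
          (piSchwartzBruhatEquiv (↥(maximalRealSubfield L)) (Fin n') (φ₁ ⊗ₜ[ℂ] finSBReindex (↥(maximalRealSubfield L)) e₁ Φf))
          (charCM ξ) ν 2)} =
      {v : ↥(Lp ℂ 2 ν) | ∃ Φf : FinSB (↥(maximalRealSubfield L)) (Fin N × Fin 1),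
        (∀ k ∈ K', finPairRep (↥(maximalRealSubfield L)) L (IsCMField.complexConj L) N 1 e₁ (Matrix.diagonal dV) (JW (↥(maximalRealSubfield L)) L a)
            (complexConj_imagUnit L) (imagUnit_ne_zero L) (imagUnit_mul_self L) (realDiagonal_isSymm L dV hdV) (isSymm_TW (↥(maximalRealSubfield L)) a)
            (isUnit_det_realDiagonal L dV hdV hdV0) (isUnit_det_TW (↥(maximalRealSubfield L)) a) (realDiagonal_map L dV hdV).symm
            (JW_eq (↥(maximalRealSubfield L)) L a)
            (isCompatible_chiSplittingLine L e₁ dV hdV hdV0 (toHeckeCharacter L μ) (isUnitary_toHeckeCharacter L μ)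
              ((isOscillatorChar_toHeckeCharacter_iff μ).mpr hμ) (TW (↥(maximalRealSubfield L)) a) (isSymm_TW (↥(maximalRealSubfield L)) a)
              (isUnit_det_TW (↥(maximalRealSubfield L)) a) (JW (↥(maximalRealSubfield L)) L a) (JW_eq (↥(maximalRealSubfield L)) L a))
            (k, 1) Φf = Φf) ∧
        v = MemLp.toLp _ (memLp_toQuotFun_lineThetaLift L N H e₁ dV hdV hdV0 ιA hιA μ hμ a hρ μW
          (piSBReindex (↥(maximalRealSubfield L)) e₁ (piSchwartzBruhatEquiv (↥(maximalRealSubfield L)) (Fin N × Fin 1)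
            (schwartzReindexCLM (↥(maximalRealSubfield L)) e₁.symm φ₁ ⊗ₜ[ℂ] Φf)))
          (charCM ξ) ν 2)} := by
    ext v
    constructor
    · rintro ⟨Φf, hfix, rfl⟩
      exact ⟨Φf, hfix, toLp_lineThetaLift_congr L N H e₁ dV hdV hdV0 ιA hιA μ hμ a hρ μW (charCM ξ) ν (hre Φf)⟩
    · rintro ⟨Φf, hfix, rfl⟩
      exact ⟨Φf, hfix, toLp_lineThetaLift_congr L N H e₁ dV hdV hdV0 ιA hιA μ hμ a hρ μW (charCM ξ) ν (hre Φf).symm⟩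
  rw [hset]
  exact finiteDimensional_span_toLp_lineThetaLift_tensor_of_fixed L N H e₁ dV hdV hdV0 ιA hιA μ hμ a hρ μW
    (schwartzReindexCLM (↥(maximalRealSubfield L)) e₁.symm φ₁) ν hn' ξ K' hK'o hK'c

end Slice

end Summit.HodgeConjecture.HodgeConjecture.Cruxes.HLiu418.F0LD1ThetaClassFinSliceFinite

end
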